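import Literature.AlgebraicTopology.CharacteristicClasses.ProjectiveSphereSets
import Literature.AlgebraicTopology.SingularHomology.ProductPieces
import Literature.AlgebraicTopology.SingularHomology.LerayHirschTransport
import HarnessLib

/-!
# The sphere classes of the punctured affine chart of `ℙ(V)`, with parameters

Topic `Literature/AlgebraicTopology/CharacteristicClasses`. A. Hatcher, *Algebraic Topology*
(2002), §3.1 p. 204 (`H*(Sⁿ)` by induction over the cover by two hemispheres, Mayer–Vietoris) and
Example 3.40 / Thm. 3.16 (`H*(X × Sⁿ) ≅ H*(X) ⊗ H*(Sⁿ)`); D. Husemoller, *Fibre Bundles*, 3rd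
ed. (1994), Ch. 17 §1–§2 (Leray–Hirsch over the trivialised projective bundle `T × ℂPⁿ⁻¹`).

For a parameter space `T` and the fibre `ℙ ℂ V` (functional `ψ`, `ψ u = 1`, real coordinates
`e : ker ψ ≃L[ℝ] ℝᴹ` of the affine chart `U_ψ`, `ProjectiveSphereSets`), inside `X = T × ℙ ℂ V`
with `p = pr₁`, we construct by induction over the hemispherical decomposition
(`SphereSets.Zp N ∪ Zm N = Z (N + 1)`, `Zp N ∩ Zm N = Z N`) the **sphere classes**
`sph N ∈ Hᴺ_X(T × Z N)` — `sph 0` is `p*1` on `T × {w₀ > 0}` and `0` on `T × {w₀ < 0}`, and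
`sph (N + 1) = δ(sph N)` — and PROVE:

* `twoSummand_sph` — **`Hʲ_X(T × Z N) = p*Hʲ(T) ⊕ (sph N) ⌣ p^♯Hʲ⁻ᴺ(T)`** (`TwoSummand`, the
  products-free Künneth formula for `T × Sᴺ`), for `N + 1 ≤ M`, from the tree's suspension step
  `TwoSummand.union` and base `TwoSummand.of_disjoint` (`SuspensionDecomposition`), the pieces
  `T × Zp N`, `T × Zm N` having `p*` bijective (star-convex, `ProductPieces`);
* `pullH_sph` — **naturality in `T`**: `(g × 𝟙)* sph_{T₁} N = sph_{T₂} N` for `g : T₂ → T₁`;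
* the packaging on the sphere `T × (U_ψ ∩ projChart P)` = `T × Z (M - 1)`: `sphereClass`,
  `twoSummand_sphereClass`, `pullH_sphereClass`.

Everything is proved; no named facts.

## References

* [HatcherAT2002] A. Hatcher, *Algebraic Topology*, CUP 2002, §3.1 p. 204, Example 3.40.
* [HusemollerFibreBundles1994] D. Husemoller, *Fibre Bundles*, 3rd ed. (1994), Ch. 17 §1 Thm. 1.1, §2 (2.3).
-/

noncomputable section

-- as in `SuspensionDecomposition`: chains of the concrete complex are `Finsupp`s up to unfolding
-- of semireducible definitions
set_option backward.isDefEq.respectTransparency false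

open CategoryTheory Function Set
open Literature.AlgebraicTopology.SingularHomology Literature.AlgebraicTopology.SingularHomology.subsetCochains
open scoped LinearAlgebra.Projectivization

namespace Literature.AlgebraicTopology.CharacteristicClasses

variable {R : Type} [CommRing R]

/-- Local notation: the coefficient object `ULift R` of `ModuleCat R`. -/
local notation "𝑹" => SimplexSpan.coefR R

variable {V : Type} [NormedAddCommGroup V] [NormedSpace ℂ V] {ψ : StrongDual ℂ V} {u : V} (hu : ψ u = 1)
  {Mdim : ℕ} (e : ↥(LinearMap.ker (ψ : V →ₗ[ℂ] ℂ)) ≃L[ℝ] (Fin Mdim → ℝ)) (T : Type) [TopologicalSpace T]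

/-! ### The fibre pieces `T × pieceSet Zs` -/

/-- The projection `p = pr₁ : T × ℙ V → T`. [folklore] -/
abbrev prT : C(T × ℙ ℂ V, T) := ContinuousMap.fst

/-- **The fibre piece `T × pieceSet Zs ⊆ T × ℙ V`.** [folklore] -/
def fibSet (Zs : Set (Fin Mdim → ℝ)) : Set (T × ℙ ℂ V) := Prod.snd ⁻¹' pieceSet hu e Zs

/-- Fibre pieces of open sets are open. [folklore] -/
theorem isOpen_fibSet {Zs : Set (Fin Mdim → ℝ)} (hZ : IsOpen Zs) : IsOpen (fibSet hu e T Zs) :=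
  (isOpen_pieceSet hu e hZ).preimage continuous_snd

omit [TopologicalSpace T] in
/-- `fibSet` commutes with intersections. [folklore] -/
theorem fibSet_inter (Z₁ Z₂ : Set (Fin Mdim → ℝ)) :
    fibSet hu e T (Z₁ ∩ Z₂) = fibSet hu e T Z₁ ∩ fibSet hu e T Z₂ := by
  rw [fibSet, pieceSet_inter]
  rfl

omit [TopologicalSpace T] in
/-- `fibSet` commutes with unions. [folklore] -/
theorem fibSet_union (Z₁ Z₂ : Set (Fin Mdim → ℝ)) :
    fibSet hu e T (Z₁ ∪ Z₂) = fibSet hu e T Z₁ ∪ fibSet hu e T Z₂ := by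
  rw [fibSet, pieceSet_union]
  rfl

omit [TopologicalSpace T] in
/-- `fibSet ∅ = ∅`. [folklore] -/
theorem fibSet_empty : fibSet hu e T (∅ : Set (Fin Mdim → ℝ)) = ∅ := by
  rw [fibSet, pieceSet_empty]
  rfl

/-- **`p*` is bijective onto `H*_X(T × pieceSet Zs)` for `Zs` star-convex** (the piece is
`T × (contractible)`). [cite: HatcherAT2002, §3.1 p. 201] -/
theorem pullT_fibSet_bijective {Zs : Set (Fin Mdim → ℝ)} {c : Fin Mdim → ℝ} (hZ : StarConvex ℝ c Zs) (hc : c ∈ Zs)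
    (j : ℕ) : Function.Bijective (pullT (R := R) (prT T) (fibSet hu e T Zs) j) := by
  haveI := contractibleSpace_pieceSet hu e hZ hc
  exact pullT_fst_bijective_of_contractible (R := R) (pieceSet hu e Zs) j

open SphereSets

omit [TopologicalSpace T] in
/-- `T × Zp N ∩ T × Zm N = T × Z N`. [cite: HatcherAT2002, §3.1 p. 204] -/
theorem fibSet_Zp_inter_Zm (N : ℕ) : fibSet hu e T (Zp N) ∩ fibSet hu e T (Zm N) = fibSet hu e T (Z N) := by
  rw [← fibSet_inter, Zp_inter_Zm]

omit [TopologicalSpace T] in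
/-- `T × Zp N ∪ T × Zm N = T × Z (N + 1)`. [cite: HatcherAT2002, §3.1 p. 204] -/
theorem fibSet_Zp_union_Zm (N : ℕ) : fibSet hu e T (Zp N) ∪ fibSet hu e T (Zm N) = fibSet hu e T (Z (N + 1)) := by
  rw [← fibSet_union, Zp_union_Zm]

omit [TopologicalSpace T] in
/-- `T × Z 0 = T × Hp 0 ∪ T × Hm 0`. [folklore] -/
theorem fibSet_Z_zero : fibSet hu e T (Z 0) = fibSet hu e T (Hp 0) ∪ fibSet hu e T (Hm 0) := by
  rw [← fibSet_union, Z_zero]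

omit [TopologicalSpace T] in
/-- `T × Hp 0 ∩ T × Hm 0 = ∅`. [folklore] -/
theorem fibSet_Hp_inter_Hm : fibSet hu e T (Hp 0) ∩ fibSet hu e T (Hm 0) = ∅ := by
  rw [← fibSet_inter, Hp_inter_Hm, fibSet_empty]

/-! ### The sphere classes -/

variable (R)

/-- The base class on `T × (Hp 0 ⊔ Hm 0)`: `p*1` on `T × Hp 0`, `0` on `T × Hm 0`
(`H⁰(T × S⁰) = H⁰(T) ⊕ H⁰(T)`). [cite: HatcherAT2002, §3.1 p. 204] -/
def sphBase : (subsetCochains R 𝑹 (fibSet hu e T (Hp 0) ∪ fibSet hu e T (Hm 0))).homology 0 :=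
  Classical.choose (exists_of_disjoint (isOpen_fibSet hu e T (isOpen_Hp 0)) (isOpen_fibSet hu e T (isOpen_Hm 0))
    (fibSet_Hp_inter_Hm hu e T) 0 (pullT (prT T) (fibSet hu e T (Hp 0)) 0 (singularCohomology.one R T)) 0)

/-- The defining restrictions of the base class. [folklore] -/
theorem sphBase_spec :
    resH (N := 𝑹) subset_union_left 0 (sphBase R hu e T) = pullT (prT T) (fibSet hu e T (Hp 0)) 0 (singularCohomology.one R T) ∧
      resH (N := 𝑹) subset_union_right 0 (sphBase R hu e T) = 0 :=
  Classical.choose_spec (exists_of_disjoint (isOpen_fibSet hu e T (isOpen_Hp 0)) (isOpen_fibSet hu e T (isOpen_Hm 0))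
    (fibSet_Hp_inter_Hm hu e T) 0 (pullT (prT T) (fibSet hu e T (Hp 0)) 0 (singularCohomology.one R T)) 0)

/-- A class on `T × (Hp 0 ⊔ Hm 0)` with the defining restrictions of the base class is the base
class. [folklore] -/
theorem eq_sphBase (w : (subsetCochains R 𝑹 (fibSet hu e T (Hp 0) ∪ fibSet hu e T (Hm 0))).homology 0)
    (h1 : resH (N := 𝑹) subset_union_left 0 w = pullT (prT T) (fibSet hu e T (Hp 0)) 0 (singularCohomology.one R T))
    (h2 : resH (N := 𝑹) subset_union_right 0 w = 0) : w = sphBase R hu e T := by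
  rw [← sub_eq_zero]
  apply eq_zero_of_resH_zero_of_disjoint (isOpen_fibSet hu e T (isOpen_Hp 0)) (isOpen_fibSet hu e T (isOpen_Hm 0))
    (fibSet_Hp_inter_Hm hu e T)
  · rw [map_sub, h1, (sphBase_spec R hu e T).1, sub_self]
  · rw [map_sub, h2, (sphBase_spec R hu e T).2, sub_self]

/-- **The sphere classes `sph N ∈ Hᴺ_X(T × Z N)`**: `sph 0` the base class, `sph (N + 1) = δ(sph N)`
for the cover `T × Zp N`, `T × Zm N` of `T × Z (N + 1)` (Hatcher 2002, §3.1 p. 204: the generator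
of `Hⁿ(Sⁿ)` as an iterated Mayer–Vietoris coboundary). [cite: HatcherAT2002, §3.1 p. 204] -/
def sph : (N : ℕ) → (subsetCochains R 𝑹 (fibSet hu e T (Z N))).homology N
  | 0 => resH (N := 𝑹) (fibSet_Z_zero hu e T).subset 0 (sphBase R hu e T)
  | N + 1 => resH (N := 𝑹) (fibSet_Zp_union_Zm hu e T N).symm.subset (N + 1)
      (mvδ R 𝑹 (isOpen_fibSet hu e T (isOpen_Zp N)) (isOpen_fibSet hu e T (isOpen_Zm N)) N
        (resH (N := 𝑹) (fibSet_Zp_inter_Zm hu e T N).subset N (sph N)))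

/-- `sph 0` unfolded. [folklore] -/
theorem sph_zero : sph R hu e T 0 = resH (N := 𝑹) (fibSet_Z_zero hu e T).subset 0 (sphBase R hu e T) := rfl

/-- `sph (N + 1)` unfolded. [folklore] -/
theorem sph_succ (N : ℕ) : sph R hu e T (N + 1) = resH (N := 𝑹) (fibSet_Zp_union_Zm hu e T N).symm.subset (N + 1)
    (mvδ R 𝑹 (isOpen_fibSet hu e T (isOpen_Zp N)) (isOpen_fibSet hu e T (isOpen_Zm N)) N
      (resH (N := 𝑹) (fibSet_Zp_inter_Zm hu e T N).subset N (sph R hu e T N))) := rfl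

/-- **The sphere classes decompose: `Hʲ_X(T × Z N) = p*Hʲ(T) ⊕ (sph N) ⌣ p^♯Hʲ⁻ᴺ(T)`** for
`N + 1 ≤ M` (Hatcher 2002, Example 3.40 / §3.1 p. 204, the cohomology of `T × Sᴺ` without
products; Husemoller Ch. 17 §1, the trivial-bundle case of Leray–Hirsch). [cite: HatcherAT2002, §3.1 p. 204] -/
theorem twoSummand_sph : ∀ N, N + 1 ≤ Mdim → TwoSummand (prT T) (fibSet hu e T (Z N)) N (sph R hu e T N)
  | 0, h => by
    have h0 : 0 < Mdim := by omega
    obtain ⟨s₀', h1, h2, hS⟩ := TwoSummand.of_disjoint (isOpen_fibSet hu e T (isOpen_Hp 0))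
      (isOpen_fibSet hu e T (isOpen_Hm 0))
      (pullT_fibSet_bijective (R := R) hu e T (starConvex_Hp 0 h0) (single_mem_Hp 0 h0))
      (pullT_fibSet_bijective (R := R) hu e T (starConvex_Hm 0 h0) (single_mem_Hm 0 h0)) (fibSet_Hp_inter_Hm hu e T)
    rw [eq_sphBase R hu e T s₀' h1 h2] at hS
    exact TwoSummand.res_of_eq _ (fibSet_Z_zero hu e T) hS
  | N + 1, h => by
    have hN : N + 1 < Mdim := by omega
    have ih := twoSummand_sph N (by omega)
    have h1 := TwoSummand.res_of_eq (prT T) (fibSet_Zp_inter_Zm hu e T N) ih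
    have h2 := TwoSummand.union (isOpen_fibSet hu e T (isOpen_Zp N)) (isOpen_fibSet hu e T (isOpen_Zm N))
      (pullT_fibSet_bijective (R := R) hu e T (starConvex_Zp N hN) (single_mem_Zp N hN))
      (pullT_fibSet_bijective (R := R) hu e T (starConvex_Zm N hN) (single_mem_Zm N hN)) h1
    exact TwoSummand.res_of_eq (prT T) (fibSet_Zp_union_Zm hu e T N).symm h2

/-! ### Naturality in the parameter space -/

section Naturality

variable {T} {T₂ : Type} [TopologicalSpace T₂] (g : C(T₂, T))

/-- `g × 𝟙 : T₂ × ℙ V → T × ℙ V`. [folklore] -/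
abbrev prodMapId : C(T₂ × ℙ ℂ V, T × ℙ ℂ V) := g.prodMap (ContinuousMap.id (ℙ ℂ V))

/-- `g × 𝟙` maps fibre pieces to fibre pieces. [folklore] -/
theorem mapsTo_prodMapId (Zs : Set (Fin Mdim → ℝ)) :
    MapsTo (prodMapId (V := V) g) (fibSet hu e T₂ Zs) (fibSet hu e T Zs) := fun _ hx ↦ hx

/-- `(g × 𝟙)⁻¹ (T × piece) = T₂ × piece`. [folklore] -/
theorem preimage_prodMapId_fibSet (Zs : Set (Fin Mdim → ℝ)) :
    prodMapId (V := V) g ⁻¹' fibSet hu e T Zs = fibSet hu e T₂ Zs := rfl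

/-- `p ∘ (g × 𝟙) = g ∘ p₂`. [folklore] -/
theorem prT_comp_prodMapId : (prT T).comp (prodMapId (V := V) g) = g.comp (prT T₂) := rfl

/-- `f*` commutes with restriction, elementwise (the tree's `resH_comp_pullH`). [folklore] -/
theorem pullH_resH_apply {X Y : Type} [TopologicalSpace X] [TopologicalSpace Y] (f : C(X, Y)) {U U' : Set X} {W W' : Set Y}
    (hU : U' ⊆ U) (hW : W' ⊆ W) (h : MapsTo f U W) (h' : MapsTo f U' W') (j : ℕ)
    (y : (subsetCochains R 𝑹 W).homology j) :
    pullH (N := 𝑹) f h' j (resH (N := 𝑹) hW j y) = resH (N := 𝑹) hU j (pullH (N := 𝑹) f h j y) := by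
  have := ConcreteCategory.congr_hom (resH_comp_pullH (N := 𝑹) f hU hW h h' j) y
  rwa [ModuleCat.comp_apply, ModuleCat.comp_apply] at this

/-- `(g × 𝟙)*` commutes with the Mayer–Vietoris coboundaries of the fibre pieces, elementwise. [folklore] -/
theorem pullH_mvδ {Z₁ Z₂ : Set (Fin Mdim → ℝ)} (hZ₁ : IsOpen Z₁) (hZ₂ : IsOpen Z₂)
    (hmU : MapsTo (prodMapId (V := V) g) (fibSet hu e T₂ Z₁ ∪ fibSet hu e T₂ Z₂) (fibSet hu e T Z₁ ∪ fibSet hu e T Z₂))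
    (hmI : MapsTo (prodMapId (V := V) g) (fibSet hu e T₂ Z₁ ∩ fibSet hu e T₂ Z₂) (fibSet hu e T Z₁ ∩ fibSet hu e T Z₂))
    (j : ℕ) (y : (subsetCochains R 𝑹 (fibSet hu e T Z₁ ∩ fibSet hu e T Z₂)).homology j) :
    pullH (N := 𝑹) (prodMapId g) hmU (j + 1) (mvδ R 𝑹 (isOpen_fibSet hu e T hZ₁) (isOpen_fibSet hu e T hZ₂) j y) =
      mvδ R 𝑹 (isOpen_fibSet hu e T₂ hZ₁) (isOpen_fibSet hu e T₂ hZ₂) j (pullH (N := 𝑹) (prodMapId g) hmI j y) := by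
  have := ConcreteCategory.congr_hom (mvδ_pull (N := 𝑹) (prodMapId (V := V) g) (fibSet hu e T Z₁) (fibSet hu e T Z₂)
    (isOpen_fibSet hu e T hZ₁) (isOpen_fibSet hu e T hZ₂) j) y
  rw [ModuleCat.comp_apply, ModuleCat.comp_apply] at this
  exact this

/-- **`(g × 𝟙)*` of the base class is the base class.** [folklore] -/
theorem pullH_sphBase (hmU : MapsTo (prodMapId (V := V) g) (fibSet hu e T₂ (Hp 0) ∪ fibSet hu e T₂ (Hm 0))
      (fibSet hu e T (Hp 0) ∪ fibSet hu e T (Hm 0))) :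
    pullH (N := 𝑹) (prodMapId g) hmU 0 (sphBase R hu e T) = sphBase R hu e T₂ := by
  apply eq_sphBase
  · have := ConcreteCategory.congr_hom (resH_comp_pullH (N := 𝑹) (prodMapId (V := V) g)
      (subset_union_left : fibSet hu e T₂ (Hp 0) ⊆ _) (subset_union_left : fibSet hu e T (Hp 0) ⊆ _)
      hmU (mapsTo_prodMapId hu e g (Hp 0)) 0) (sphBase R hu e T)
    rw [ModuleCat.comp_apply, ModuleCat.comp_apply] at this
    rw [← this, (sphBase_spec R hu e T).1]
    exact pullH_pullT_one (prT T₂) (prodMapId g) (mapsTo_prodMapId hu e g (Hp 0)) (prT T)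
  · have := ConcreteCategory.congr_hom (resH_comp_pullH (N := 𝑹) (prodMapId (V := V) g)
      (subset_union_right : fibSet hu e T₂ (Hm 0) ⊆ _) (subset_union_right : fibSet hu e T (Hm 0) ⊆ _)
      hmU (mapsTo_prodMapId hu e g (Hm 0)) 0) (sphBase R hu e T)
    rw [ModuleCat.comp_apply, ModuleCat.comp_apply] at this
    rw [← this, (sphBase_spec R hu e T).2, map_zero]

/-- **Naturality of the sphere classes in the parameter space: `(g × 𝟙)* sph_T N = sph_{T₂} N`.** [folklore] -/
theorem pullH_sph : ∀ N : ℕ,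
    pullH (N := 𝑹) (prodMapId g) (mapsTo_prodMapId hu e g (Z N)) N (sph R hu e T N) = sph R hu e T₂ N
  | 0 => by
    have hmU : MapsTo (prodMapId (V := V) g) (fibSet hu e T₂ (Hp 0) ∪ fibSet hu e T₂ (Hm 0))
        (fibSet hu e T (Hp 0) ∪ fibSet hu e T (Hm 0)) := fun _ hx ↦ hx
    rw [sph_zero, sph_zero, pullH_resH_apply R (prodMapId g) (fibSet_Z_zero hu e T₂).subset (fibSet_Z_zero hu e T).subset
      hmU (mapsTo_prodMapId hu e g (Z 0)), pullH_sphBase R hu e g hmU]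
  | N + 1 => by
    have ih := pullH_sph N
    have hmU : MapsTo (prodMapId (V := V) g) (fibSet hu e T₂ (Zp N) ∪ fibSet hu e T₂ (Zm N))
        (fibSet hu e T (Zp N) ∪ fibSet hu e T (Zm N)) := fun _ hx ↦ hx
    have hmI : MapsTo (prodMapId (V := V) g) (fibSet hu e T₂ (Zp N) ∩ fibSet hu e T₂ (Zm N))
        (fibSet hu e T (Zp N) ∩ fibSet hu e T (Zm N)) := fun _ hx ↦ hx
    rw [sph_succ, sph_succ, pullH_resH_apply R (prodMapId g) (fibSet_Zp_union_Zm hu e T₂ N).symm.subset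
      (fibSet_Zp_union_Zm hu e T N).symm.subset hmU (mapsTo_prodMapId hu e g (Z (N + 1)))]
    have hδ := pullH_mvδ R hu e g (isOpen_Zp N) (isOpen_Zm N) hmU hmI N
      (resH (N := 𝑹) (fibSet_Zp_inter_Zm hu e T N).subset N (sph R hu e T N))
    have hr := pullH_resH_apply R (prodMapId g) (fibSet_Zp_inter_Zm hu e T₂ N).subset
      (fibSet_Zp_inter_Zm hu e T N).subset (mapsTo_prodMapId hu e g (Z N)) hmI N (sph R hu e T N)
    rw [ih] at hr
    rw [← hr, ← hδ]

end Naturality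

/-! ### The sphere `T × (U_ψ ∖ [u])` and its class -/

section Sphere

variable {T}

omit [TopologicalSpace T] in
/-- **`T × Z (M - 1) = T × U_ψ ∩ T × projChart P`** — the parametrised punctured chart. [folklore] -/
theorem fibSet_Z_pred (hM : 0 < Mdim) :
    fibSet hu e T (Z (Mdim - 1)) =
      (Prod.snd : T × ℙ ℂ V → ℙ ℂ V) ⁻¹' chartDomain (ψ : Module.Dual ℂ V) ∩
        (Prod.snd : T × ℙ ℂ V → ℙ ℂ V) ⁻¹' projChart (hyperplaneProj ψ u) := by
  rw [fibSet, Z_pred_eq hM, pieceSet_compl_zero]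
  rfl

variable (T)

/-- **The sphere class `s ∈ Hᴹ⁻¹_X(T × (U_ψ ∖ [u]))`** of the parametrised punctured affine chart
(`U_ψ ∖ [u] ≃ ℝᴹ ∖ 0 ≃ Sᴹ⁻¹`). [cite: HatcherAT2002, §3.1 p. 204] -/
def sphereClass (hM : 0 < Mdim) :
    (subsetCochains R 𝑹 ((Prod.snd : T × ℙ ℂ V → ℙ ℂ V) ⁻¹' chartDomain (ψ : Module.Dual ℂ V) ∩
      (Prod.snd : T × ℙ ℂ V → ℙ ℂ V) ⁻¹' projChart (hyperplaneProj ψ u))).homology (Mdim - 1) :=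
  resH (N := 𝑹) (fibSet_Z_pred hu e hM).symm.subset (Mdim - 1) (sph R hu e T (Mdim - 1))

/-- **The sphere class decomposes `H*_X(T × (U_ψ ∖ [u]))` as `p*H*(T) ⊕ s ⌣ p^♯H*⁻ᴹ⁺¹(T)`**
(`Hʲ(T × Sᴹ⁻¹) = Hʲ(T) ⊕ Hʲ⁻ᴹ⁺¹(T)`). [cite: HatcherAT2002, Example 3.40] -/
theorem twoSummand_sphereClass (hM : 0 < Mdim) :
    TwoSummand (prT T) ((Prod.snd : T × ℙ ℂ V → ℙ ℂ V) ⁻¹' chartDomain (ψ : Module.Dual ℂ V) ∩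
      (Prod.snd : T × ℙ ℂ V → ℙ ℂ V) ⁻¹' projChart (hyperplaneProj ψ u)) (Mdim - 1) (sphereClass R hu e T hM) :=
  TwoSummand.res_of_eq (prT T) (fibSet_Z_pred hu e hM).symm (twoSummand_sph R hu e T (Mdim - 1) (by omega))

variable {T} {T₂ : Type} [TopologicalSpace T₂] (g : C(T₂, T))

/-- **Naturality of the sphere class in `T`.** [folklore] -/
theorem pullH_sphereClass (hM : 0 < Mdim)
    (hm : MapsTo (prodMapId (V := V) g)
      ((Prod.snd : T₂ × ℙ ℂ V → ℙ ℂ V) ⁻¹' chartDomain (ψ : Module.Dual ℂ V) ∩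
        (Prod.snd : T₂ × ℙ ℂ V → ℙ ℂ V) ⁻¹' projChart (hyperplaneProj ψ u))
      ((Prod.snd : T × ℙ ℂ V → ℙ ℂ V) ⁻¹' chartDomain (ψ : Module.Dual ℂ V) ∩
        (Prod.snd : T × ℙ ℂ V → ℙ ℂ V) ⁻¹' projChart (hyperplaneProj ψ u))) :
    pullH (N := 𝑹) (prodMapId g) hm (Mdim - 1) (sphereClass R hu e T hM) = sphereClass R hu e T₂ hM := by
  rw [sphereClass, sphereClass, pullH_resH_apply R (prodMapId g) (fibSet_Z_pred hu e (T := T₂) hM).symm.subset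
    (fibSet_Z_pred hu e (T := T) hM).symm.subset (mapsTo_prodMapId hu e g (Z (Mdim - 1))) hm, pullH_sph]

end Sphere

end Literature.AlgebraicTopology.CharacteristicClasses
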